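import Summits.QuantumFields.BalabanUV.T4Continuum.Support.MinimalActionRate

/-!
# T⁴ programme, node NE3 (η-rate of the minimisers) — THE ACTION SANDWICH, part 5: EXISTENCE OF THE LIMIT OF THE
# MINIMAL ACTIONS FROM THE UPPER HALF ALONE (no refinement hypothesis): `A_k(V)` is almost non-decreasing with a
# summable defect and uniformly bounded, hence convergent

Sixteenth generation of the NE3 prover lineage P1 of the cell `pub-balaban` (unit `b2b-balaban-t4-ne3-p1`, OWNER of
`BINDER-OWNERS.md` row NE3), file 5 of the «action sandwich» series (parts 1–4: `MinimalActionLevels`,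
`MinimalActionSandwich`, `MinimalActionRate`, `MinimalActionWitness`).

THE POINT.  Part 3's two-sided rate `|A_k(V) − A_{k+1}(V)| ≤ C(L^{−2})^k N^d` needs BOTH halves of the sandwich; the LOWER
half needs the refinement hypothesis (H2) (a `Regular` configuration of run `k+1` whose one-step average IS the run-`k`
minimiser), whose gradient clause is one dictionary step away from print (the one-step response reading).  The UPPER
half `A_k ≤ A_{k+1} + (L^{4−d})^{k+1}𝓓(U_{k+1})` needs ONLY (H1) minimisers, (H3) their printed-TYPE regularity and (H4)
class membership of their averages — B11 Thm 1 TYPE verbatim + B7 Prop. 1 — typed here as `UpperData` (§1).  And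
the upper half ALONE already gives EXISTENCE of the limit: with `e_k := [wallConstNA(d,L)(g+b³)/L²]·(L^{−2})^k·N^d`
(summable, `L ≥ 2`) one has `A_k ≤ A_{k+1} + e_k` (`minAct_le_succ_rate`, §2), and the minimal actions are UNIFORMLY
BOUNDED, `A_{k+1}(V) ≤ ½·#Plane(d)·b²·N^d` (`levelAction_le_of_regular`, §3: the Wilson weight of a unitary is at most
half the squared operator distance to `1`, tree `MatrixNorms.two_mul_one_sub_nReTr_le_opDist1_sq` = B12 (0.14), and a
`Regular` configuration has `|U(∂p) − 1| ≤ b(L^k)^{−2}` on the `(N L^k)^d·#Plane` plaquettes of its period, against the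
weight `(L^{4−d})^k`); an almost non-decreasing, bounded sequence with summable defects converges (`tendsto_of_le_succ_add`,
§4, elementary: `k ↦ A_k + Σ_{j<k} e_j` is monotone and bounded).  MAIN THEOREM (§5) **`exists_tendsto_minAct`**: under
`UpperData 𝒞 L N b g V`, `L ≥ 2`, `N ≥ 1`, `0 ≤ b`, `512(d+1)(d+4)L²b ≤ 1`, `0 ≤ g`: `∃ A, Tendsto (k ↦ A_k(V)) atTop (𝓝 A)`
— the EXISTENCE half of the rung-(B)+1 statement for the minimal actions rests on verbatim-TYPE inputs only; the RATE
(and with it the Cauchy modulus the node's `ActionRate` records) is what the refinement hypothesis (H2) of part 3 buys.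
`SandwichData.toUpperData` records that part 3's hypothesis is the stronger one.

HONEST FRAMING.  Finite-T⁴ ultraviolet bookkeeping about MINIMISERS (rung (B)+1 of the cell's ladder); the only
estimate used is row NE3-R2's PROVED `abs_deficit_torus_le`; no conditional of the cell (`BetaPertH`, (B), (B^μ)) is
used or hidden; nothing bears on infinite volume, a mass gap, or the Clay problem; NE3 is NOT proved (`UpperData` is a
hypothesis SHAPE of B11 Thm 1 TYPE, asserted for no datum).  ABSOLUTE RULE of the cell kept: no printed sentence is a
hypothesis; no `sorry`, no axioms beyond Mathlib's.  PLACEMENT (human rule 2026-08-19): cell work under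
`Summits/QuantumFields/BalabanUV/`; imports `Support.MinimalActionRate` only; moves nothing.  Records:
`t4/T4-EST-U1b-OSC.md` v1.34, `t4/T4-EST-NE3-P1.md` v2.33 of the cell `pub-balaban`.
-/

set_option autoImplicit false

open scoped BigOperators Matrix Matrix.Norms.L2Operator Topology
open NormedSpace Finset Filter

namespace Summit.QuantumFields.BalabanUV.T4Continuum.MinimalActionLimit

open Literature.MathematicalPhysics.QuantumFieldTheory.Balaban1983to89
open B7Prop1Explicit B7Prop2Explicit MatrixLog UnitaryModel
open T4AveragingDeficitWall hiding Site Plane Plaq Bond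
open T4AveragingDeficitWallBoundary (IsPeriodicCfg periodBox blockSites_periodBox mem_periodBox card_periodBox)
open T4AveragingDeficitNonAbelian (wallConstNA wallConstNA_nonneg abs_deficit_torus_le)
open MinimalActionLevels MinimalActionSandwich MinimalActionRate

noncomputable section

variable {d : ℕ} {n : Type*} [Fintype n] [DecidableEq n]

local notation "𝕄" => Matrix n n ℂ
local notation "Site" => B7Prop1Explicit.Site

/-! ## §1 The hypotheses of the upper half -/

variable (d) in
/-- **THE UPPER-HALF DATA of a datum `V`** (a SHAPE, asserted for no datum here) — `SandwichData` without the refinement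
clause (H2): for every level `k`, (H1) run `k` has a minimiser; (H3) every minimiser of run `k+1` is `Regular … (k+1)`;
(H4) its rescaled one-step average lies in `𝒞 k`.  Dictionary: B11 Thm 1 (existence in (8), regularity (8)–(10)) at
every level + B7 Prop. 1; nothing else. [folklore] -/
@[folklore]
structure UpperData (𝒞 : ℕ → Set (Site d → Fin d → 𝕄ˣ)) (L N : ℕ) (b g : ℝ) (V : Site d → Fin d → 𝕄ˣ) : Prop where
  /-- (H1) existence of a minimiser of every run -/
  exists_minimiser : ∀ k : ℕ, ∃ U, IsMinimiser d 𝒞 L N k V U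
  /-- (H3) regularity of the minimisers -/
  regular : ∀ (k : ℕ) (U : Site d → Fin d → 𝕄ˣ), IsMinimiser d 𝒞 L N (k + 1) V U → Regular d L N b g (k + 1) U
  /-- (H4) the averaged finer minimiser lies in the coarser class -/
  avg_mem : ∀ (k : ℕ) (U : Site d → Fin d → 𝕄ˣ), IsMinimiser d 𝒞 L N (k + 1) V U → rescale L (bavg L U) ∈ 𝒞 k

/-- Part 3's `SandwichData` is the stronger hypothesis. [folklore] -/
theorem _root_.Summit.QuantumFields.BalabanUV.T4Continuum.MinimalActionRate.SandwichData.toUpperData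
    {𝒞 : ℕ → Set (Site d → Fin d → 𝕄ˣ)} {L N : ℕ} {b g : ℝ} {V : Site d → Fin d → 𝕄ˣ}
    (h : SandwichData d 𝒞 L N b g V) : UpperData d 𝒞 L N b g V :=
  ⟨h.exists_minimiser, h.regular, h.avg_mem⟩

/-! ## §2 The one-sided rate from the upper half -/

/-- **THE UPPER HALF WITH THE WALL AND THE SCALING**: under `UpperData`, for `L, N ≥ 1`, `0 ≤ b`, `512(d+1)(d+4)L²b ≤ 1`
and every `k`:  `A_k(V) ≤ A_{k+1}(V) + [wallConstNA(d,L)(g + b³)/L²]·(L^{−2})^k·N^d` — part 2's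
`minAct_le_succ_add` for the run-`(k+1)` minimiser, its deficit bounded by row NE3-R2's wall (`abs_deficit_level_le`) and
the scaling algebra of part 3 (`rate_algebra`).  No refinement is used. [folklore] -/
theorem minAct_le_succ_rate [Nonempty n] {𝒞 : ℕ → Set (Site d → Fin d → 𝕄ˣ)} {L N : ℕ} (hL : 1 ≤ L) (hN : 1 ≤ N)
    {b g : ℝ} (hb : 0 ≤ b) (hbs : 512 * (d + 1) * (d + 4) * (L : ℝ) ^ 2 * b ≤ 1)
    {V : Site d → Fin d → 𝕄ˣ} (h : UpperData d 𝒞 L N b g V) (k : ℕ) :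
    minAct d 𝒞 L N k V
      ≤ minAct d 𝒞 L N (k + 1) V + wallConstNA d L * (g + b ^ 3) / (L : ℝ) ^ 2 * (((L : ℝ) ^ 2)⁻¹) ^ k * (N : ℝ) ^ d := by
  obtain ⟨UA, hA⟩ := h.exists_minimiser k
  obtain ⟨UB, hB⟩ := h.exists_minimiser (k + 1)
  have hBreg := h.regular k UB hB
  have hW := h.avg_mem k UB hB
  have hL0 : (0 : ℝ) < L := by exact_mod_cast (by omega : 0 < L)
  have hL1 : (1 : ℝ) ≤ L := by exact_mod_cast hL
  set s : ℝ := (L : ℝ) ^ (k + 1) with hsdef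
  have hs1 : 1 ≤ s := one_le_pow₀ hL1
  have hs2 : 1 ≤ s ^ 2 := one_le_pow₀ hs1
  set a : ℝ := b / s ^ 2 with hadef
  have ha : 0 ≤ a := div_nonneg hb (by positivity)
  have hab : a ≤ b := div_le_self hb hs2
  have hsmall : 512 * (d + 1) * (d + 4) * (L : ℝ) ^ 2 * a ≤ 1 := by
    have hc : 0 ≤ 512 * ((d : ℝ) + 1) * (d + 4) * (L : ℝ) ^ 2 := by positivity
    nlinarith
  -- part 2's upper half and the wall for the run-(k+1) minimiser
  have hup := minAct_le_succ_add hL hA hB hW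
  have hdef := abs_deficit_level_le hL hN hBreg.unitary hBreg.periodic ha hsmall hBreg.small (k := k)
  have hNr : (0 : ℝ) ≤ (N : ℝ) ^ d := by positivity
  have hM : ((N * L ^ k : ℕ) : ℝ) ^ d ≤ (N : ℝ) ^ d * s ^ d := by
    push_cast
    rw [mul_pow]
    refine mul_le_mul_of_nonneg_left ?_ hNr
    exact pow_le_pow_left₀ (by positivity) (pow_le_pow_right₀ hL1 (Nat.le_succ k)) d
  have ha3 : a ^ 3 * ((N * L ^ k : ℕ) : ℝ) ^ d ≤ b ^ 3 * (N : ℝ) ^ d * s ^ d / s ^ 6 := by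
    have h1 : a ^ 3 = b ^ 3 / s ^ 6 := by rw [hadef, div_pow, ← pow_mul]
    rw [h1, div_mul_eq_mul_div, mul_assoc]
    exact div_le_div_of_nonneg_right (mul_le_mul_of_nonneg_left hM (pow_nonneg hb 3)) (by positivity)
  have hG : gradFluxSq UB (periodBox (N * L ^ (k + 1))) ≤ g * (N : ℝ) ^ d * s ^ d / s ^ 6 := hBreg.grad
  have hsum : gradFluxSq UB (periodBox (N * L ^ (k + 1))) + a ^ 3 * ((N * L ^ k : ℕ) : ℝ) ^ d
      ≤ (g + b ^ 3) * (N : ℝ) ^ d * s ^ d / s ^ 6 := by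
    have : (g + b ^ 3) * (N : ℝ) ^ d * s ^ d / s ^ 6
        = g * (N : ℝ) ^ d * s ^ d / s ^ 6 + b ^ 3 * (N : ℝ) ^ d * s ^ d / s ^ 6 := by ring
    rw [this]; linarith
  have hWc := wallConstNA_nonneg (d := d) L
  have hc : 0 ≤ ((stepWt d L)⁻¹) ^ (k + 1) := pow_nonneg (inv_nonneg.mpr (stepWt_pos (d := d) L hL).le) _
  have hchain : ((stepWt d L)⁻¹) ^ (k + 1) * deficit L UB (blockWindow L (periodBox (N * L ^ k)))
      ≤ ((stepWt d L)⁻¹) ^ (k + 1) * (wallConstNA d L * ((g + b ^ 3) * (N : ℝ) ^ d * s ^ d / s ^ 6)) := by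
    refine mul_le_mul_of_nonneg_left (((le_abs_self _).trans hdef).trans ?_) hc
    exact mul_le_mul_of_nonneg_left hsum hWc
  have heq : ((stepWt d L)⁻¹) ^ (k + 1) * (wallConstNA d L * ((g + b ^ 3) * (N : ℝ) ^ d * s ^ d / s ^ 6))
      = wallConstNA d L * (g + b ^ 3) / (L : ℝ) ^ 2 * (((L : ℝ) ^ 2)⁻¹) ^ k * (N : ℝ) ^ d := by
    rw [stepWt_inv_eq (d := d) L hL, hsdef]
    exact rate_algebra hL0.ne' k
  linarith

/-! ## §3 A uniform bound on the minimal actions from the regularity radius -/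

/-- The Wilson weight of a unitary is at most half the squared operator distance to `1`: `1 − Re tr W ≤ ½|W − 1|²`
(B12 (0.14) `‖U − 1‖² = 2[1 − Re tr U]` with `‖·‖ ≤ |·|`; tree `MatrixNorms.two_mul_one_sub_nReTr_le_opDist1_sq`).
[cite: Balaban1987RG1, (0.14) p.254] -/
theorem wt_le_half_norm_sq [Nonempty n] {W : 𝕄ˣ} (hW : W ∈ unitaryUnits 𝕄) :
    wt W ≤ ‖(W : 𝕄) - 1‖ ^ 2 / 2 := by
  have h := MatrixNorms.two_mul_one_sub_nReTr_le_opDist1_sq (n := n) (U := (W : 𝕄)) (mem_unitaryUnits.mp hW)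
  unfold wt
  unfold UnitaryModel.opDist1 at h
  linarith

/-- The level-`k` action of a `U(N)`-valued configuration with `|U(∂p) − 1| ≤ r` everywhere is at most
`(L^{4−d})^k·(N L^k)^d·#Plane(d)·r²/2`. [folklore] -/
theorem levelAction_le_of_smallField [Nonempty n] (L N k : ℕ) (hL : 1 ≤ L) {U : Site d → Fin d → 𝕄ˣ}
    (hU : IsUnitaryCfg U) {r : ℝ} (hr : SmallField U r) :
    levelAction d L N k U
      ≤ ((stepWt d L)⁻¹) ^ k
          * (((N * L ^ k : ℕ) : ℝ) ^ d * Fintype.card (T4AveragingDeficitWall.Plane d) * (r ^ 2 / 2)) := by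
  have hc : 0 ≤ ((stepWt d L)⁻¹) ^ k := pow_nonneg (inv_nonneg.mpr (stepWt_pos (d := d) L hL).le) _
  unfold levelAction
  refine mul_le_mul_of_nonneg_left ?_ hc
  unfold fineAction
  have hpt : ∀ p ∈ perWin d (N * L ^ k), wt (fhol U p) ≤ r ^ 2 / 2 := by
    intro p _
    have hu : fhol U p ∈ unitaryUnits 𝕄 := hol_mem_of hU _ _
    have hr0 : 0 ≤ r := (norm_nonneg _).trans (hr p.1 p.2.1.1 p.2.1.2 (ne_of_lt p.2.2))
    refine (wt_le_half_norm_sq hu).trans ?_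
    have h1 : ‖((fhol U p : 𝕄ˣ) : 𝕄) - 1‖ ≤ r := hr p.1 p.2.1.1 p.2.1.2 (ne_of_lt p.2.2)
    have h2 : ‖((fhol U p : 𝕄ˣ) : 𝕄) - 1‖ ^ 2 ≤ r ^ 2 := pow_le_pow_left₀ (norm_nonneg _) h1 2
    linarith
  refine (Finset.sum_le_sum hpt).trans (le_of_eq ?_)
  rw [Finset.sum_const, card_perWin, nsmul_eq_mul]
  push_cast
  ring

/-- **A `Regular … k` configuration has level-`k` action at most `½·#Plane(d)·b²·N^d`, UNIFORMLY IN `k`**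
(radius `b(L^k)^{−2}` on `(NL^k)^d·#Plane` plaquettes against the weight `(L^{4−d})^k`:
`(L^4/L^d)^k·(NL^k)^d·b²(L^k)^{−4}/2 = N^d b²/2`). [folklore] -/
theorem levelAction_le_of_regular [Nonempty n] {L N k : ℕ} (hL : 1 ≤ L) {b g : ℝ} {U : Site d → Fin d → 𝕄ˣ}
    (hU : Regular d L N b g k U) :
    levelAction d L N k U ≤ Fintype.card (T4AveragingDeficitWall.Plane d) * b ^ 2 / 2 * (N : ℝ) ^ d := by
  have hL0 : (L : ℝ) ≠ 0 := by exact_mod_cast (by omega : L ≠ 0)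
  refine (levelAction_le_of_smallField L N k hL hU.unitary hU.small).trans (le_of_eq ?_)
  rw [stepWt_inv_eq (d := d) L hL, div_pow]
  push_cast
  rw [mul_pow, div_pow, ← pow_mul, ← pow_mul, ← pow_mul, ← pow_mul]
  field_simp
  ring

/-- Hence under `UpperData` the minimal actions of the runs `k+1` are uniformly bounded:
`A_{k+1}(V) ≤ ½·#Plane(d)·b²·N^d`. [folklore] -/
theorem minAct_succ_le [Nonempty n] {𝒞 : ℕ → Set (Site d → Fin d → 𝕄ˣ)} {L N : ℕ} (hL : 1 ≤ L) {b g : ℝ}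
    {V : Site d → Fin d → 𝕄ˣ} (h : UpperData d 𝒞 L N b g V) (k : ℕ) :
    minAct d 𝒞 L N (k + 1) V ≤ Fintype.card (T4AveragingDeficitWall.Plane d) * b ^ 2 / 2 * (N : ℝ) ^ d := by
  obtain ⟨UB, hB⟩ := h.exists_minimiser (k + 1)
  rw [hB.minAct_eq]
  exact levelAction_le_of_regular hL (h.regular k UB hB)

/-! ## §4 Almost non-decreasing bounded sequences with summable defects converge -/

/-- **Elementary**: if `a_k ≤ a_{k+1} + e_k` with `e ≥ 0` summable and `a` is bounded above, then `a` converges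
(`k ↦ a_k + Σ_{j<k} e_j` is monotone and bounded above, and the partial sums of `e` converge). [folklore] -/
theorem tendsto_of_le_succ_add {a e : ℕ → ℝ} (he : Summable e) (he0 : ∀ k, 0 ≤ e k)
    (h : ∀ k, a k ≤ a (k + 1) + e k) {B : ℝ} (hB : ∀ k, a k ≤ B) :
    ∃ A : ℝ, Tendsto a atTop (𝓝 A) := by
  set c : ℕ → ℝ := fun k => a k + ∑ j ∈ Finset.range k, e j with hcdef
  have hmono : Monotone c := by
    refine monotone_nat_of_le_succ fun k => ?_
    simp only [hcdef, Finset.sum_range_succ]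
    linarith [h k]
  have hbdd : BddAbove (Set.range c) := by
    refine ⟨B + ∑' j, e j, ?_⟩
    rintro _ ⟨k, rfl⟩
    have hpart : ∑ j ∈ Finset.range k, e j ≤ ∑' j, e j :=
      he.sum_le_tsum (Finset.range k) fun j _ => he0 j
    simp only [hcdef]
    linarith [hB k]
  have hc : Tendsto c atTop (𝓝 (⨆ k, c k)) := tendsto_atTop_ciSup hmono hbdd
  have hs : Tendsto (fun k => ∑ j ∈ Finset.range k, e j) atTop (𝓝 (∑' j, e j)) := he.hasSum.tendsto_sum_nat
  refine ⟨(⨆ k, c k) - ∑' j, e j, ?_⟩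
  have heq : a = fun k => c k - ∑ j ∈ Finset.range k, e j := by
    funext k; simp only [hcdef]; ring
  rw [heq]
  exact hc.sub hs

/-! ## §5 Existence of the limit of the minimal actions -/

/-- **EXISTENCE OF `lim_k A_k(V)` FROM THE UPPER HALF ALONE.**  Under `UpperData 𝒞 L N b g V` (minimisers exist, are
`Regular`, and average into the coarser class — B11 Thm 1 TYPE + B7 Prop. 1, NO refinement hypothesis), for `L ≥ 2`,
`N ≥ 1`, `0 ≤ b`, `512(d+1)(d+4)L²b ≤ 1`, `0 ≤ g`: the minimal level actions converge, `∃ A, A_k(V) → A`.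
Proof: `A_k ≤ A_{k+1} + e_k` with `e_k = [wallConstNA(d,L)(g+b³)/L²](L^{−2})^k N^d` summable (§2), `A_{k+1} ≤ ½#Plane·b²N^d`
(§3), and §4.  The RATE of convergence is NOT asserted here (that is part 3, under (H2)). [folklore] -/
theorem exists_tendsto_minAct [Nonempty n] {𝒞 : ℕ → Set (Site d → Fin d → 𝕄ˣ)} {L N : ℕ} (hL : 2 ≤ L) (hN : 1 ≤ N)
    {b g : ℝ} (hb : 0 ≤ b) (hbs : 512 * (d + 1) * (d + 4) * (L : ℝ) ^ 2 * b ≤ 1) (hg : 0 ≤ g)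
    {V : Site d → Fin d → 𝕄ˣ} (h : UpperData d 𝒞 L N b g V) :
    ∃ A : ℝ, Tendsto (fun k => minAct d 𝒞 L N k V) atTop (𝓝 A) := by
  have hL1 : 1 ≤ L := by omega
  obtain ⟨hθ0, hθ1⟩ := rate_lt_one hL
  set C : ℝ := wallConstNA d L * (g + b ^ 3) / (L : ℝ) ^ 2 * (N : ℝ) ^ d with hCdef
  have hC : 0 ≤ C := by
    have := wallConstNA_nonneg (d := d) L
    rw [hCdef]; positivity
  -- the defects `e_k = C θ^k`
  have he : Summable fun k : ℕ => C * (((L : ℝ) ^ 2)⁻¹) ^ k :=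
    (summable_geometric_of_lt_one hθ0 hθ1).mul_left C
  have he0 : ∀ k, 0 ≤ C * (((L : ℝ) ^ 2)⁻¹) ^ k := fun k => mul_nonneg hC (pow_nonneg hθ0 k)
  have hstep : ∀ k, minAct d 𝒞 L N k V ≤ minAct d 𝒞 L N (k + 1) V + C * (((L : ℝ) ^ 2)⁻¹) ^ k := by
    intro k
    have := minAct_le_succ_rate hL1 hN hb hbs h k
    rw [hCdef]
    calc minAct d 𝒞 L N k V
        ≤ minAct d 𝒞 L N (k + 1) V
            + wallConstNA d L * (g + b ^ 3) / (L : ℝ) ^ 2 * (((L : ℝ) ^ 2)⁻¹) ^ k * (N : ℝ) ^ d := this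
      _ = minAct d 𝒞 L N (k + 1) V
            + wallConstNA d L * (g + b ^ 3) / (L : ℝ) ^ 2 * (N : ℝ) ^ d * (((L : ℝ) ^ 2)⁻¹) ^ k := by ring
  -- the uniform bound: `A_{k+1} ≤ B₀` for all `k`, and `A_0 ≤ A_1 + e_0 ≤ B₀ + C`
  set B₀ : ℝ := Fintype.card (T4AveragingDeficitWall.Plane d) * b ^ 2 / 2 * (N : ℝ) ^ d with hB₀def
  have hsucc : ∀ k, minAct d 𝒞 L N (k + 1) V ≤ B₀ := fun k => minAct_succ_le hL1 h k
  have hB : ∀ k, minAct d 𝒞 L N k V ≤ B₀ + C := by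
    intro k
    cases k with
    | zero =>
      have h0 := hstep 0
      rw [pow_zero, mul_one] at h0
      linarith [hsucc 0]
    | succ k => linarith [hsucc k]
  exact tendsto_of_le_succ_add he he0 hstep hB

/-- The same under part 3's `SandwichData` (which implies `UpperData`). [folklore] -/
theorem exists_tendsto_minAct_of_sandwichData [Nonempty n] {𝒞 : ℕ → Set (Site d → Fin d → 𝕄ˣ)} {L N : ℕ}
    (hL : 2 ≤ L) (hN : 1 ≤ N) {b g : ℝ} (hb : 0 ≤ b) (hbs : 512 * (d + 1) * (d + 4) * (L : ℝ) ^ 2 * b ≤ 1)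
    (hg : 0 ≤ g) {V : Site d → Fin d → 𝕄ˣ} (h : SandwichData d 𝒞 L N b g V) :
    ∃ A : ℝ, Tendsto (fun k => minAct d 𝒞 L N k V) atTop (𝓝 A) :=
  exists_tendsto_minAct hL hN hb hbs hg h.toUpperData

/-! ## §6 (v1.1, append-only) Under the full `SandwichData`: the limit WITH its geometric tail -/

/-- **THE LIMIT OF THE MINIMAL ACTIONS WITH ITS GEOMETRIC TAIL** (under part 3's `SandwichData`, i.e. WITH the
refinement hypothesis (H2)): `∃ A, A_k(V) → A ∧ ∀ k, |A_k(V) − A| ≤ [wallConstNA(d,L)(g+b³)/L²]·N^d·(L^{−2})^k/(1 − L^{−2})`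
— the node's `T4EtaRateMin.ActionRate.exists_limit` applied to `actionRate_of_sandwichData` (`L ≥ 2` for `L^{−2} < 1`).
This is the rung-(B)+1 form «existence of the ε → 0 limit, with a rate» for the ACTION VALUES, conditional on B11
Thm 1 TYPE inputs only. [folklore] -/
theorem exists_tendsto_minAct_tail [Nonempty n] {𝒞 : ℕ → Set (Site d → Fin d → 𝕄ˣ)} {L N : ℕ} (hL : 2 ≤ L)
    (hN : 1 ≤ N) {b g : ℝ} (hb : 0 ≤ b) (hbs : 512 * (d + 1) * (d + 4) * (L : ℝ) ^ 2 * b ≤ 1)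
    {V : Site d → Fin d → 𝕄ˣ} (h : SandwichData d 𝒞 L N b g V) :
    ∃ A : ℝ, Tendsto (fun k => minAct d 𝒞 L N k V) atTop (𝓝 A) ∧
      ∀ k : ℕ, |minAct d 𝒞 L N k V - A|
        ≤ wallConstNA d L * (g + b ^ 3) / (L : ℝ) ^ 2 * (N : ℝ) ^ d * (((L : ℝ) ^ 2)⁻¹) ^ k
            / (1 - ((L : ℝ) ^ 2)⁻¹) := by
  have hL1 : 1 ≤ L := by omega
  have hrate := actionRate_of_sandwichData (dom := {V}) hL1 hN hb hbs
    (fun W hW => by rw [Set.mem_singleton_iff.mp hW]; exact h) (fun (_ : ℕ) (_ : Site d → Fin d → 𝕄ˣ) (_ : Unit) => (0 : ℝ))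
  exact hrate.exists_limit (rate_lt_one hL).2 (Set.mem_singleton V)

/-! ## §7 (v1.2, append-only) The ONE-SIDED tail from the upper half alone -/

/-- Telescoping the one-sided steps: `a_k ≤ a_m + Σ_{k ≤ j < m} e_j` for `k ≤ m`. [folklore] -/
theorem le_add_sum_Ico_of_le_succ_add {a e : ℕ → ℝ} (h : ∀ k, a k ≤ a (k + 1) + e k) {k m : ℕ} (hkm : k ≤ m) :
    a k ≤ a m + ∑ j ∈ Finset.Ico k m, e j := by
  induction m, hkm using Nat.le_induction with
  | base => simp
  | succ m hkm ih =>
    rw [Finset.sum_Ico_succ_top hkm]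
    linarith [h m]

/-- **One-sided tail, elementary**: if `a_k ≤ a_{k+1} + e_k` with `e ≥ 0` summable and `a → A`, then
`a_k ≤ A + Σ_{j} e_{j+k}` for every `k` (let `m → ∞` in the telescoped inequality). [folklore] -/
theorem le_lim_add_tsum_of_le_succ_add {a e : ℕ → ℝ} (he : Summable e) (he0 : ∀ k, 0 ≤ e k)
    (h : ∀ k, a k ≤ a (k + 1) + e k) {A : ℝ} (hA : Tendsto a atTop (𝓝 A)) (k : ℕ) :
    a k ≤ A + ∑' j, e (j + k) := by
  have hek : Summable fun j => e (j + k) := (summable_nat_add_iff k).mpr he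
  have hbound : ∀ m, k ≤ m → a k ≤ a m + ∑' j, e (j + k) := by
    intro m hkm
    refine (le_add_sum_Ico_of_le_succ_add h hkm).trans (add_le_add le_rfl ?_)
    have hreindex : ∑ j ∈ Finset.Ico k m, e j = ∑ j ∈ Finset.range (m - k), e (j + k) := by
      rw [Finset.sum_Ico_eq_sum_range]
      exact Finset.sum_congr rfl fun j _ => by rw [add_comm]
    rw [hreindex]
    exact hek.sum_le_tsum (Finset.range (m - k)) fun j _ => he0 (j + k)
  have hlim : Tendsto (fun m => a m + ∑' j, e (j + k)) atTop (𝓝 (A + ∑' j, e (j + k))) := hA.add_const _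
  exact ge_of_tendsto hlim (Filter.eventually_atTop.mpr ⟨k, hbound⟩)

/-- **THE ONE-SIDED GEOMETRIC TAIL FROM THE UPPER HALF ALONE**: under `UpperData` (NO refinement hypothesis), with
`A = lim_k A_k(V)` from `exists_tendsto_minAct`, every minimal action exceeds the limit by at most the geometric tail,
`A_k(V) ≤ A + [wallConstNA(d,L)(g+b³)/L²]·N^d·(L^{−2})^k/(1 − L^{−2})` — half of the rate statement of §6 from verbatim
B11 Thm 1 TYPE inputs; the matching lower estimate `A − tail ≤ A_k(V)` is what (H2) adds. [folklore] -/
theorem exists_tendsto_minAct_upperTail [Nonempty n] {𝒞 : ℕ → Set (Site d → Fin d → 𝕄ˣ)} {L N : ℕ} (hL : 2 ≤ L)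
    (hN : 1 ≤ N) {b g : ℝ} (hb : 0 ≤ b) (hbs : 512 * (d + 1) * (d + 4) * (L : ℝ) ^ 2 * b ≤ 1) (hg : 0 ≤ g)
    {V : Site d → Fin d → 𝕄ˣ} (h : UpperData d 𝒞 L N b g V) :
    ∃ A : ℝ, Tendsto (fun k => minAct d 𝒞 L N k V) atTop (𝓝 A) ∧
      ∀ k : ℕ, minAct d 𝒞 L N k V
        ≤ A + wallConstNA d L * (g + b ^ 3) / (L : ℝ) ^ 2 * (N : ℝ) ^ d * (((L : ℝ) ^ 2)⁻¹) ^ k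
            / (1 - ((L : ℝ) ^ 2)⁻¹) := by
  have hL1 : 1 ≤ L := by omega
  obtain ⟨hθ0, hθ1⟩ := rate_lt_one hL
  obtain ⟨A, hA⟩ := exists_tendsto_minAct hL hN hb hbs hg h
  set C : ℝ := wallConstNA d L * (g + b ^ 3) / (L : ℝ) ^ 2 * (N : ℝ) ^ d with hCdef
  set θ : ℝ := ((L : ℝ) ^ 2)⁻¹ with hθdef
  have hC : 0 ≤ C := by
    have := wallConstNA_nonneg (d := d) L
    rw [hCdef]; positivity
  have he : Summable fun k : ℕ => C * θ ^ k := (summable_geometric_of_lt_one hθ0 hθ1).mul_left C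
  have he0 : ∀ k, 0 ≤ C * θ ^ k := fun k => mul_nonneg hC (pow_nonneg hθ0 k)
  have hstep : ∀ k, minAct d 𝒞 L N k V ≤ minAct d 𝒞 L N (k + 1) V + C * θ ^ k := by
    intro k
    have := minAct_le_succ_rate hL1 hN hb hbs h k
    rw [hCdef, hθdef]
    calc minAct d 𝒞 L N k V
        ≤ minAct d 𝒞 L N (k + 1) V
            + wallConstNA d L * (g + b ^ 3) / (L : ℝ) ^ 2 * (((L : ℝ) ^ 2)⁻¹) ^ k * (N : ℝ) ^ d := this
      _ = minAct d 𝒞 L N (k + 1) V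
            + wallConstNA d L * (g + b ^ 3) / (L : ℝ) ^ 2 * (N : ℝ) ^ d * (((L : ℝ) ^ 2)⁻¹) ^ k := by ring
  refine ⟨A, hA, fun k => ?_⟩
  have htail := le_lim_add_tsum_of_le_succ_add he he0 hstep hA k
  have htsum : ∑' j, C * θ ^ (j + k) = C * θ ^ k / (1 - θ) := by
    have h1 : ∀ j, C * θ ^ (j + k) = C * θ ^ k * θ ^ j := fun j => by rw [pow_add]; ring
    simp_rw [h1]
    rw [tsum_mul_left, tsum_geometric_of_lt_one hθ0 hθ1]
    field_simp
  rw [htsum] at htail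
  calc minAct d 𝒞 L N k V ≤ A + C * θ ^ k / (1 - θ) := htail
    _ = A + wallConstNA d L * (g + b ^ 3) / (L : ℝ) ^ 2 * (N : ℝ) ^ d * (((L : ℝ) ^ 2)⁻¹) ^ k
          / (1 - ((L : ℝ) ^ 2)⁻¹) := by rw [hCdef, hθdef]

end

end Summit.QuantumFields.BalabanUV.T4Continuum.MinimalActionLimit
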